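import Summits.SmoothPoincare4.SmoothPoincare4.Theorems.ConvexBisectionAcyclicBisectionExistsCrossingCount
import HarnessLib

/-!
# A page loop crossing an annulus chart exactly once
(wave 6, brick G7-1 of the repair lemma N3b′ "shadows of charted embedded page curves are
primitive or zero" for node N3b `node_STembed` of stub `stub_STgeo` = N3 of NF4, line
`modp-braid-orbits`, crux `ConvexBisection.AcyclicBisectionExists`, item stmt-SmoothPoincare4-10508;
registered sub-goal `helper_exists_loop_crossing_once`)

The SURGERY step of the dual-curve argument (Farb–Margalit, *Primer*, §1.3 and §6.1: a simple
closed curve with non-zero algebraic intersection with some curve is met exactly once by a closed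
curve).  Let `φ` be an annulus chart of `page g c` (continuous, `1`-periodic, page-valued,
injective on `[0, 1) × (−1, 1)`), `|k| < 1/2` a level, and `K` a loop of the page with two
parameters `lo`, `hi` such that

* on the closed parameter interval between `lo` and `hi` the loop never meets the level circle
  `φ(ℝ × {k})` (`hfree`),
* `K (e^{2πi lo})` lies in the open annulus BELOW the level (`height < k`) and `K (e^{2πi hi})`
  lies in the open annulus ABOVE it (`height > k`).

Then some loop `L` of the page has `crossingNumber φ L = 1` (`exists_loop_crossingNumber_eq_one`):
`L` climbs inside the annulus along the chart image of the segment from the chart coordinates of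
`K (e^{2πi lo})` to those of `K (e^{2πi hi})` (one clean upward passage of the level) and returns
along the free arc of `K` from `hi` to `lo`.  The count is done in the thin re-profiled chart
`φ_{k,η}` of a level gap `η` of the free arc (`exists_level_gap`, X7-1a) by
`crossingNumber_single_passage` (Z6-4) and `crossingNumber_reprofile` (Z6-5).
§1 descends closed unit-period paths to circle maps (`exists_circleMap_of_path`).

Everything is proved; no definitions, no named facts, no `sorry`.  References: B. Farb,
D. Margalit, *A primer on mapping class groups* (2012), §6.1 [FarbMargalit2012]; W. Fulton,
*Algebraic Topology: A First Course* (1995), §3 [Fulton1995].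
-/

noncomputable section

set_option linter.dupNamespace false

open scoped Manifold ContDiff Topology Real
open Set Function Metric Filter
open Literature.Topology.FourManifolds Literature.Topology.FourManifolds.LefschetzBase

namespace Summit.SmoothPoincare4.SmoothPoincare4.Theorems.AcyclicBisectionExists.ModpBraidOrbits

variable {g : ℕ} {c : ℂ} {φ : ℝ × ℝ → Base g} {K : sphere (0 : EuclideanSpace ℝ (Fin 2)) 1 → Base g}

/-! ## §1 Closed unit-period paths as circle maps -/

/-- **Descent of a closed path on `[0, 1]` to a circle map**: a continuous `γ : ℝ → X` with
`γ 0 = γ 1` gives a continuous circle map `L` with `L (e^{2πit}) = γ t` on `[0, 1]`, every value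
of which is a value of `γ` on `[0, 1]`. [folklore] -/
theorem exists_circleMap_of_path {X : Type*} [TopologicalSpace X] {γ : ℝ → X} (hγ : Continuous γ)
    (h01 : γ 0 = γ 1) :
    ∃ L : sphere (0 : EuclideanSpace ℝ (Fin 2)) 1 → X, Continuous L ∧
      (∀ t ∈ Icc (0 : ℝ) 1, L (circlePt t) = γ t) ∧ ∀ θ, ∃ t ∈ Icc (0 : ℝ) 1, L θ = γ t := by
  let γ' : C(unitInterval, X) := ⟨fun t => γ t, hγ.comp continuous_subtype_val⟩
  have h01' : γ' 0 = γ' 1 := h01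
  refine ⟨loopCircleMap γ' h01', (loopCircleMap γ' h01').continuous, fun t ht => ?_, fun θ => ?_⟩
  · have e : circlePt t = circleParam ⟨t, ht⟩ := rfl
    rw [e, loopCircleMap_circleParam]
    rfl
  · obtain ⟨t, rfl⟩ := circleParam_surjective θ
    exact ⟨t, t.2, by rw [loopCircleMap_circleParam]; rfl⟩

/-! ## §2 The surgery loop -/

/-- **A page loop crossing the chart exactly once.**  If the loop `K` of `page g c` lies in the
open annulus of the chart `φ` below the level `k` (`|k| < 1/2`) at the parameter `lo` and above
it at the parameter `hi`, and never meets the level circle `φ(ℝ × {k})` on the closed parameter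
interval between `lo` and `hi`, then some loop `L` of the page has `crossingNumber φ L = 1`
(the chart segment from `K (e^{2πi lo})` up to `K (e^{2πi hi})`, closed by the free arc of `K`).
[cite: FarbMargalit2012, §6.1] -/
theorem exists_loop_crossingNumber_eq_one (hc : ‖c‖ = 1) (hφc : Continuous φ)
    (hφ1 : ∀ u r, φ (u + 1, r) = φ (u, r)) (hφp : ∀ p, φ p ∈ page g c)
    (hφi : InjOn φ (Ico (0 : ℝ) 1 ×ˢ Ioo (-1 : ℝ) 1)) (hK : Continuous K)
    (hKc : ∀ θ, K θ ∈ page g c) {k : ℝ} (hk : k ∈ Ioo (-(1 / 2) : ℝ) (1 / 2)) {lo hi : ℝ}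
    (hfree : ∀ τ ∈ uIcc lo hi, K (circlePt τ) ∈ φ '' (univ ×ˢ Ioo (-1 : ℝ) 1) →
      height φ (K (circlePt τ)) ≠ k)
    (hlo : K (circlePt lo) ∈ φ '' (univ ×ˢ Ioo (-1 : ℝ) 1)) (hlok : height φ (K (circlePt lo)) < k)
    (hhi : K (circlePt hi) ∈ φ '' (univ ×ˢ Ioo (-1 : ℝ) 1)) (hhik : k < height φ (K (circlePt hi))) :
    ∃ L : sphere (0 : EuclideanSpace ℝ (Fin 2)) 1 → Base g, Continuous L ∧ (∀ θ, L θ ∈ page g c) ∧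
      crossingNumber φ L = 1 := by
  classical
  -- the level gap on the free arc
  obtain ⟨η, hη, hη4, hgap⟩ := exists_level_gap hc hφc hφ1 hφp hφi hK hKc hk isCompact_uIcc hfree
  have hkη : |k| + η ≤ 1 := by
    have : |k| < 1 / 2 := abs_lt.2 ⟨hk.1, hk.2⟩
    linarith
  -- chart coordinates `pL`, `pH` of the two end points; they are beyond the strip of the gap
  obtain ⟨hL2, hLφ⟩ := prelift_spec hlo
  obtain ⟨hH2, hHφ⟩ := prelift_spec hhi
  set pL := prelift φ (K (circlePt lo)) with hpL
  set pH := prelift φ (K (circlePt hi)) with hpH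
  have hlok' : pL.2 < k := hlok
  have hhik' : k < pH.2 := hhik
  have hrL : pL.2 < k - η := by
    by_contra h
    push Not at h
    exact hgap lo left_mem_uIcc ⟨pL, ⟨trivial, h, by linarith⟩, hLφ⟩
  have hrH : k + η < pH.2 := by
    by_contra h
    push Not at h
    exact hgap hi right_mem_uIcc ⟨pH, ⟨trivial, by linarith, h⟩, hHφ⟩
  have hd : 0 < pH.2 - pL.2 := by linarith
  -- the height profile `f` and the abscissa profile `x` of the climbing segment
  obtain ⟨f, hf⟩ : ∃ f : ℝ → ℝ, ∀ τ, f τ = pL.2 + 2 * τ * (pH.2 - pL.2) := ⟨_, fun _ => rfl⟩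
  obtain ⟨x, hx⟩ : ∃ x : ℝ → ℝ, ∀ τ, x τ = pL.1 + 2 * τ * (pH.1 - pL.1) := ⟨_, fun _ => rfl⟩
  have hfc : Continuous f := by
    rw [show f = fun τ => pL.2 + 2 * τ * (pH.2 - pL.2) from funext hf]; fun_prop
  have hxc : Continuous x := by
    rw [show x = fun τ => pL.1 + 2 * τ * (pH.1 - pL.1) from funext hx]; fun_prop
  have hfmono : ∀ a b, a ≤ b → f a ≤ f b := fun a b hab => by
    rw [hf, hf]; nlinarith
  have hf0 : f 0 = pL.2 := by rw [hf]; ring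
  have hf12 : f (1 / 2) = pH.2 := by rw [hf]; ring
  have hx0 : x 0 = pL.1 := by rw [hx]; ring
  have hx12 : x (1 / 2) = pH.1 := by rw [hx]; ring
  have hfI : ∀ τ ∈ Icc (0 : ℝ) (1 / 2), f τ ∈ Ioo (-1 : ℝ) 1 := fun τ hτ =>
    ⟨by linarith [hL2.1, hfmono 0 τ hτ.1], by linarith [hH2.2, hfmono τ (1 / 2) hτ.2]⟩
  -- the closed path: the segment on `[0, 1/2]`, the free arc of `K` from `hi` to `lo` on `[1/2, 1]`
  have hjoin : φ (x (1 / 2), f (1 / 2)) = K (circlePt (hi + (2 * (1 / 2 : ℝ) - 1) * (lo - hi))) := by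
    rw [hx12, hf12, Prod.mk.eta, hHφ, show hi + (2 * (1 / 2 : ℝ) - 1) * (lo - hi) = hi by ring]
  obtain ⟨γ, hγ⟩ : ∃ γ : ℝ → Base g, ∀ τ, γ τ =
      if τ ≤ 1 / 2 then φ (x τ, f τ) else K (circlePt (hi + (2 * τ - 1) * (lo - hi))) :=
    ⟨_, fun _ => rfl⟩
  have hγc : Continuous γ := by
    rw [show γ = fun τ => if τ ≤ 1 / 2 then φ (x τ, f τ)
        else K (circlePt (hi + (2 * τ - 1) * (lo - hi))) from funext hγ]
    refine Continuous.if_le (hφc.comp (hxc.prodMk hfc))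
      (hK.comp (continuous_circlePt.comp (by fun_prop))) continuous_id continuous_const ?_
    rintro τ rfl
    exact hjoin
  have hγ0 : γ 0 = K (circlePt lo) := by
    rw [hγ, if_pos (by norm_num : (0 : ℝ) ≤ 1 / 2), hx0, hf0, Prod.mk.eta, hLφ]
  have hγ1 : γ 1 = K (circlePt lo) := by
    rw [hγ, if_neg (by norm_num : ¬ (1 : ℝ) ≤ 1 / 2), show hi + (2 * (1 : ℝ) - 1) * (lo - hi) = lo by ring]
  obtain ⟨L, hL, hLγ, hLval⟩ := exists_circleMap_of_path hγc (hγ0.trans hγ1.symm)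
  have hγp : ∀ τ, γ τ ∈ page g c := fun τ => by
    rw [hγ]
    split_ifs
    · exact hφp _
    · exact hKc _
  have hLc : ∀ θ, L θ ∈ page g c := fun θ => by
    obtain ⟨t, -, ht⟩ := hLval θ
    rw [ht]
    exact hγp t
  -- the loop read on the two halves
  have hLseg : ∀ τ ∈ Icc (0 : ℝ) (1 / 2), L (circlePt τ) = φ (x τ, f τ) := fun τ hτ => by
    rw [hLγ τ ⟨hτ.1, by linarith [hτ.2]⟩, hγ, if_pos hτ.2]
  have hLarc : ∀ τ ∈ Icc (1 / 2 : ℝ) 1,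
      L (circlePt τ) = K (circlePt (hi + (2 * τ - 1) * (lo - hi))) := fun τ hτ => by
    rw [hLγ τ ⟨by linarith [hτ.1], hτ.2⟩, hγ]
    by_cases h : τ ≤ 1 / 2
    · rw [if_pos h, show τ = 1 / 2 from le_antisymm h hτ.1, hjoin]
    · rw [if_neg h]
  have hLsegA : ∀ τ ∈ Icc (0 : ℝ) (1 / 2), L (circlePt τ) ∈ φ '' (univ ×ˢ Ioo (-1 : ℝ) 1) ∧
      height φ (L (circlePt τ)) = f τ := fun τ hτ => by
    rw [hLseg τ hτ]
    exact ⟨⟨(x τ, f τ), ⟨trivial, hfI τ hτ⟩, rfl⟩, height_of_lift hφ1 hφi (hfI τ hτ)⟩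
  have harcI : ∀ τ ∈ Icc (1 / 2 : ℝ) 1, hi + (2 * τ - 1) * (lo - hi) ∈ uIcc lo hi := fun τ hτ => by
    rcases le_total lo hi with h | h
    · rw [uIcc_of_le h]; constructor <;> nlinarith [hτ.1, hτ.2]
    · rw [uIcc_of_ge h]; constructor <;> nlinarith [hτ.1, hτ.2]
  -- the passage parameters `s < t` in `[0, 1/2]`: heights `k ∓ 3η/4`
  obtain ⟨s, hs, hfs⟩ : ∃ s ∈ Icc (0 : ℝ) (1 / 2), f s = k - 3 * η / 4 := by
    have h := intermediate_value_Icc (show (0 : ℝ) ≤ 1 / 2 by norm_num) hfc.continuousOn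
    exact h ⟨by rw [hf0]; linarith, by rw [hf12]; linarith⟩
  obtain ⟨t, ht, hft⟩ : ∃ t ∈ Icc (0 : ℝ) (1 / 2), f t = k + 3 * η / 4 := by
    have h := intermediate_value_Icc (show (0 : ℝ) ≤ 1 / 2 by norm_num) hfc.continuousOn
    exact h ⟨by rw [hf0]; linarith, by rw [hf12]; linarith⟩
  have hst : s < t := by
    by_contra h
    push Not at h
    have := hfmono t s h
    rw [hfs, hft] at this
    linarith
  -- one clean upward passage in the re-profiled chart `φ_{k,η}`
  have hφ'c : Continuous fun p : ℝ × ℝ => φ (p.1, k + η * p.2) :=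
    hφc.comp (continuous_fst.prodMk (continuous_const.add (continuous_const.mul continuous_snd)))
  have hone : crossingNumber (fun p : ℝ × ℝ => φ (p.1, k + η * p.2)) L = 1 := by
    refine crossingNumber_single_passage hc hφ'c (reprofile_periodic hφ1 k η)
      (reprofile_mem_page hφp k η) (reprofile_injOn hφi hη hkη) hL hLc hs.1 hst.le
      (by linarith [ht.2]) ?_ ?_ ?_ ?_ ?_
    · -- inside the thin annulus on `[s, t]`
      intro τ hτ
      have hτI : τ ∈ Icc (0 : ℝ) (1 / 2) := ⟨hs.1.trans hτ.1, hτ.2.trans ht.2⟩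
      obtain ⟨hA, hh⟩ := hLsegA τ hτI
      refine mem_annulus_reprofile hη hA ?_
      rw [hh, abs_lt]
      have h1 := hfmono s τ hτ.1
      have h2 := hfmono τ t hτ.2
      rw [hfs] at h1
      rw [hft] at h2
      constructor <;> linarith
    · -- off the thin collar on `[0, s]`
      intro τ hτ hmem
      obtain ⟨-, hh⟩ := hLsegA τ ⟨hτ.1, hτ.2.trans hs.2⟩
      obtain ⟨-, hle⟩ := height_of_mem_collar_reprofile hφ1 hφi hη hkη hmem
      rw [hh] at hle
      have h1 := hfmono τ s hτ.2
      rw [hfs] at h1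
      have := (abs_le.1 hle).1
      linarith
    · -- off the thin collar on `[t, 1]`: the end of the segment, then the free arc
      intro τ hτ hmem
      rcases le_or_gt τ (1 / 2) with hτh | hτh
      · obtain ⟨-, hh⟩ := hLsegA τ ⟨ht.1.trans hτ.1, hτh⟩
        obtain ⟨-, hle⟩ := height_of_mem_collar_reprofile hφ1 hφi hη hkη hmem
        rw [hh] at hle
        have h1 := hfmono t τ hτ.1
        rw [hft] at h1
        have := (abs_le.1 hle).2
        linarith
      · rw [hLarc τ ⟨hτh.le, hτ.2⟩] at hmem
        exact hgap _ (harcI τ ⟨hτh.le, hτ.2⟩) (mem_strip_of_mem_collar_reprofile hφ1 hφi hη hkη hmem)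
    · -- height `-3/4` at `s`
      rw [hLseg s hs, hfs, show k - 3 * η / 4 = k + η * (-(3 / 4) : ℝ) by ring]
      have e : height (fun p : ℝ × ℝ => φ (p.1, k + η * p.2)) (φ (x s, k + η * (-(3 / 4) : ℝ))) =
          -(3 / 4) :=
        height_of_lift (reprofile_periodic hφ1 k η) (reprofile_injOn hφi hη hkη) (u₀ := x s)
          (r₀ := -(3 / 4)) (by norm_num)
      rw [e]
      norm_num
    · -- height `3/4` at `t`
      rw [hLseg t ht, hft, show k + 3 * η / 4 = k + η * (3 / 4 : ℝ) by ring]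
      have e : height (fun p : ℝ × ℝ => φ (p.1, k + η * p.2)) (φ (x t, k + η * (3 / 4 : ℝ))) =
          3 / 4 :=
        height_of_lift (reprofile_periodic hφ1 k η) (reprofile_injOn hφi hη hkη) (u₀ := x t)
          (r₀ := 3 / 4) (by norm_num)
      rw [e]
      norm_num
  rw [crossingNumber_reprofile hc hφc hφ1 hφp hφi hL hLc hη hkη] at hone
  exact ⟨L, hL, hLc, hone⟩

/-! ## §3 The registered form -/

/-- **Sub-goal `helper_exists_loop_crossing_once`** (G7-1, the surgery step of the repair lemma
N3b′ of node N3b of NF4): a page loop which is below the level `k` of an annulus chart at one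
parameter, above it at another, and free of the level circle in between, yields a page loop with
crossing number `1`, in registered form. [cite: FarbMargalit2012, §6.1] -/
theorem helper_exists_loop_crossing_once : ∀ (g : ℕ) (c : ℂ) (_hc : ‖c‖ = 1) (φ : ℝ × ℝ → Literature.Topology.FourManifolds.LefschetzBase.Base g) (_hφc : Continuous φ) (_hφ1 : ∀ u r, φ (u + 1, r) = φ (u, r)) (_hφp : ∀ p, φ p ∈ Literature.Topology.FourManifolds.LefschetzBase.page g c) (_hφi : Set.InjOn φ (Set.Ico (0 : ℝ) 1 ×ˢ Set.Ioo (-1 : ℝ) 1)) (K : Metric.sphere (0 : EuclideanSpace ℝ (Fin 2)) 1 → Literature.Topology.FourManifolds.LefschetzBase.Base g) (_hK : Continuous K) (_hKc : ∀ θ, K θ ∈ Literature.Topology.FourManifolds.LefschetzBase.page g c) (k lo hi : ℝ), k ∈ Set.Ioo (-(1 / 2) : ℝ) (1 / 2) → (∀ τ ∈ Set.uIcc lo hi, K (Literature.Topology.FourManifolds.circlePt τ) ∈ φ '' (Set.univ ×ˢ Set.Ioo (-1 : ℝ) 1) → Summit.SmoothPoincare4.SmoothPoincare4.Theorems.AcyclicBisectionExists.ModpBraidOrbits.height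 φ (K (Literature.Topology.FourManifolds.circlePt τ)) ≠ k) → K (Literature.Topology.FourManifolds.circlePt lo) ∈ φ '' (Set.univ ×ˢ Set.Ioo (-1 : ℝ) 1) → Summit.SmoothPoincare4.SmoothPoincare4.Theorems.AcyclicBisectionExists.ModpBraidOrbits.height φ (K (Literature.Topology.FourManifolds.circlePt lo)) < k → K (Literature.Topology.FourManifolds.circlePt hi) ∈ φ '' (Set.univ ×ˢ Set.Ioo (-1 : ℝ) 1) → k < Summit.SmoothPoincare4.SmoothPoincare4.Theorems.AcyclicBisectionExists.ModpBraidOrbits.height φ (K (Literature.Topology.FourManifolds.circlePt hi)) → ∃ L : Metric.sphere (0 : EuclideanSpace ℝ (Fin 2)) 1 → Literature.Topology.FourManifolds.LefschetzBase.Base g, Continuous L ∧ (∀ θ, L θ ∈ Literature.Topology.FourManifolds.LefschetzBase.page g c) ∧ Summit.SmoothPoincare4.SmoothPoincare4.Theorems.AcyclicBisectionExists.ModpBraidOrbits.crossingNumber φ L = 1 :=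
  fun _ _ hc _ hφc hφ1 hφp hφi _ hK hKc _ _ _ hk hfree hlo hlok hhi hhik =>
    exists_loop_crossingNumber_eq_one hc hφc hφ1 hφp hφi hK hKc hk hfree hlo hlok hhi hhik

end Summit.SmoothPoincare4.SmoothPoincare4.Theorems.AcyclicBisectionExists.ModpBraidOrbits

end
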